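import Mathlib
import Literature.NumberTheory.Transcendental.BoxCoordinatePowerMap
import Literature.NumberTheory.Transcendental.KZFibredRelations
import HarnessLib

/-!
# OrthantCoordPowMoveWithoutOneLe — four REFUTED route-stub weakenings, deprecated (not literature)

Topic `Literature/Uncategorized`. This module holds FOUR constants, relocated here by the gate from
`Summits/KontsevichZagierPeriods/KontsevichZagierPeriods/Theorems/DilationMove/Negative/StubLoadBearing.lean`
(accept-time relocation of tagged propositions written inline in a `Summits/` proposal; human
ruling 2026-08-15). Each is the registered stub `stub_orthantCoordPowMove` of the crux
`DilationMove` (route `KontsevichZagierPeriods/HurwitzMicroSectors`, line `coordpow-api-assembly`: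
the dilation `x ↦ (xᵢ^m)ᵢ` is ONE Kontsevich–Zagier change-of-variables move on a `ℚ`-semialgebraic
domain inside the open orthant, target = the symbolic image, with the Jacobian `mⁿ ∏ᵢ xᵢ^(m-1)`)
with ONE hypothesis deleted, minted by the refuter of that crux to show that each hypothesis is
load-bearing. **All four are FALSE as stated and refuted by sorry-free theorems of the tree**
(namespace `Summit.KontsevichZagierPeriods.HurwitzMicroSectors.DilationMoveNegative`):

* `OrthantCoordPowMoveWithoutOneLe` (`1 ≤ m` deleted) — `orthantCoordPowMove_false_without_oneLe`
  (module `…Theorems.DilationMove.Negative.StubLoadBearing`): `m = 0`, `n = 1`, source `[(0,1), 0]`,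
  one-point target `[{1}, 0]`; the structural channel `covData_of_mem` demands an injection of
  `(0,1)` onto a point;
* `OrthantCoordPowMoveWithoutOrthant` (orthant hypothesis deleted) —
  `orthantCoordPowMove_false_without_orthant` (module `…Theorems.DilationMove.Negative.StubOrthant`,
  where the Summits-side copy of this constant lives): `m = 2`, `n = 1`, `[(-1,1), 2t]` vs
  `[[0,1), 1]`, values `0 ≠ 1`;
* `OrthantCoordPowMoveWithoutImage` (image clause deleted) — `orthantCoordPowMove_false_without_image`
  (module `…StubLoadBearing`, from `not_dilationMoveBoxes_target`);
* `OrthantCoordPowMoveWithoutJacobian` (Jacobian factor deleted) —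
  `orthantCoordPowMove_false_without_jacobian` (module `…StubLoadBearing`, from
  `not_dilationMoveJac_noJacobian`).

## Verdict clean-up (2026-08-16, librarian): not literature debt

No module imports this one and no declaration names these constants (checked over `Literature/`
and `Summits/`: the refuting theorems state the bodies written out, or their own Summits-side copy).
The constants are therefore orphans; they have no source, are false as written, and no
`…_holds` can ever be proved. They are retired from the named-fact debt: each declaration is
`@[deprecated]` with a pointer to its refuting theorem and its docstring says what is wrong, so
that the census stops counting them and no prove seat is placed on them. **Names and bodies are
kept byte for byte** (tree rule: deprecate, never delete). The POSITIVE statement one might want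
instead is the stub itself with all four hypotheses, a landed route obligation under `Summits/`
(`Theorems/HurwitzMicroSectorsDilationMoveStub*.lean`), not literature, and not restated here.
-/

namespace Literature.Uncategorized

open Set MvPolynomial MeasureTheory intervalIntegral
open Literature.NumberTheory.Transcendental Literature.ModelTheory.ExponentialFields

/-- **Deprecated — REFUTED as stated; a FALSE proposition, NOT a literature fact** (no source; no
`_holds` possible; never a hypothesis). `stub_orthantCoordPowMove` (crux `DilationMove`, route
`KontsevichZagierPeriods/HurwitzMicroSectors`) with the hypothesis `1 ≤ m` dropped: for ALL `m`,
the coordinate power map `Φₘ : x ↦ (xᵢ^m)ᵢ` on a `ℚ`-semialgebraic domain in the open orthant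
would be one change-of-variables move `[r] − [r'] ∈ changeOfVariablesRel` onto the image
representation with Jacobian `mⁿ ∏ᵢ xᵢ^(m-1)`. **What is wrong:** at `m = 0`, `n = 1` the map is
constant, the source `[(0,1), 0]` and the one-point target `[{1}, 0]` satisfy every remaining
hypothesis, and membership in `changeOfVariablesRel` forces an injection of `(0,1)` onto a point.
Refuting theorem:
`Summit.KontsevichZagierPeriods.HurwitzMicroSectors.DilationMoveNegative.orthantCoordPowMove_false_without_oneLe`
(module `Summits.KontsevichZagierPeriods.KontsevichZagierPeriods.Theorems.DilationMove.Negative.StubLoadBearing`,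
sorry-free; it states this body written out). Lesson for the crux: `1 ≤ m` is load-bearing.
Orphan (no importer, no user). [folklore] -/
@[deprecated "REFUTED as stated (m = 0, n = 1): see theorem \
    Summit.KontsevichZagierPeriods.HurwitzMicroSectors.DilationMoveNegative.orthantCoordPowMove_false_without_oneLe \
    (module Summits.KontsevichZagierPeriods.KontsevichZagierPeriods.Theorems.DilationMove.Negative.StubLoadBearing)"
  (since := "2026-08-16")]
def OrthantCoordPowMoveWithoutOneLe : Prop :=
  ∀ (n m : ℕ) (r r' : KZ.IntegralRep n), r.domain ⊆ {x | ∀ i, 0 < x i} →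
    IsSemialgebraicMapOn ℚ r.domain (fun x : Fin n → ℝ => BoxIntegral.coordPow m x) →
    r'.domain = (fun x : Fin n → ℝ => BoxIntegral.coordPow m x) '' r.domain →
    (∀ x ∈ r.domain, r.integrand x =
      r'.integrand (BoxIntegral.coordPow m x) * ((m : ℝ) ^ n * ∏ i, x i ^ (m - 1))) →
    KZ.of r - KZ.of r' ∈ KZ.changeOfVariablesRel

/-- **Deprecated — REFUTED as stated; a FALSE proposition, NOT a literature fact** (no source; no
`_holds` possible; never a hypothesis). `stub_orthantCoordPowMove` with the orthant hypothesis
`r.domain ⊆ (0,∞)ⁿ` dropped: the power map `Φₘ` (`m ≥ 1`) would be one change-of-variables move on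
ANY `ℚ`-semialgebraic domain. **What is wrong:** for even `m` the map is not injective across the
orthant walls — at `m = 2`, `n = 1` the source `[(-1,1), 2t]` has value `0` and the target
`[[0,1), 1]` has value `1`. Refuting theorem (of the byte-identical Summits-side copy
`…DilationMoveNegative.OrthantCoordPowMoveWithoutOrthant`):
`Summit.KontsevichZagierPeriods.HurwitzMicroSectors.DilationMoveNegative.orthantCoordPowMove_false_without_orthant`
(module `Summits.KontsevichZagierPeriods.KontsevichZagierPeriods.Theorems.DilationMove.Negative.StubOrthant`,
sorry-free). Lesson for the crux: the orthant hypothesis is load-bearing exactly for even `m`.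
Orphan (no importer, no user). [folklore] -/
@[deprecated "REFUTED as stated (m = 2, n = 1): see theorem \
    Summit.KontsevichZagierPeriods.HurwitzMicroSectors.DilationMoveNegative.orthantCoordPowMove_false_without_orthant \
    (module Summits.KontsevichZagierPeriods.KontsevichZagierPeriods.Theorems.DilationMove.Negative.StubOrthant)"
  (since := "2026-08-16")]
def OrthantCoordPowMoveWithoutOrthant : Prop :=
  ∀ (n m : ℕ), 1 ≤ m → ∀ (r r' : KZ.IntegralRep n),
    IsSemialgebraicMapOn ℚ r.domain (fun x : Fin n → ℝ => BoxIntegral.coordPow m x) →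
    r'.domain = (fun x : Fin n → ℝ => BoxIntegral.coordPow m x) '' r.domain →
    (∀ x ∈ r.domain, r.integrand x =
      r'.integrand (BoxIntegral.coordPow m x) * ((m : ℝ) ^ n * ∏ i, x i ^ (m - 1))) →
    KZ.of r - KZ.of r' ∈ KZ.changeOfVariablesRel

/-- **Deprecated — REFUTED as stated; a FALSE proposition, NOT a literature fact** (no source; no
`_holds` possible; never a hypothesis). `stub_orthantCoordPowMove` with the image clause
`r'.domain = Φₘ '' r.domain` dropped: the move would hold for an ARBITRARY target domain carrying
the pulled-back integrand. **What is wrong:** with the target domain unconstrained the two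
integrals need not agree (the refutation takes a target box of the wrong size,
`not_dilationMoveBoxes_target`). Refuting theorem:
`Summit.KontsevichZagierPeriods.HurwitzMicroSectors.DilationMoveNegative.orthantCoordPowMove_false_without_image`
(module `Summits.KontsevichZagierPeriods.KontsevichZagierPeriods.Theorems.DilationMove.Negative.StubLoadBearing`,
sorry-free; it states this body written out). Lesson for the crux: the image clause is
load-bearing. Orphan (no importer, no user). [folklore] -/
@[deprecated "REFUTED as stated: see theorem \
    Summit.KontsevichZagierPeriods.HurwitzMicroSectors.DilationMoveNegative.orthantCoordPowMove_false_without_image \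
    (module Summits.KontsevichZagierPeriods.KontsevichZagierPeriods.Theorems.DilationMove.Negative.StubLoadBearing)"
  (since := "2026-08-16")]
def OrthantCoordPowMoveWithoutImage : Prop :=
  ∀ (n m : ℕ), 1 ≤ m → ∀ (r r' : KZ.IntegralRep n), r.domain ⊆ {x | ∀ i, 0 < x i} →
    IsSemialgebraicMapOn ℚ r.domain (fun x : Fin n → ℝ => BoxIntegral.coordPow m x) →
    (∀ x ∈ r.domain, r.integrand x =
      r'.integrand (BoxIntegral.coordPow m x) * ((m : ℝ) ^ n * ∏ i, x i ^ (m - 1))) →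
    KZ.of r - KZ.of r' ∈ KZ.changeOfVariablesRel

/-- **Deprecated — REFUTED as stated; a FALSE proposition, NOT a literature fact** (no source; no
`_holds` possible; never a hypothesis). `stub_orthantCoordPowMove` with the Jacobian factor
`mⁿ ∏ᵢ xᵢ^(m-1)` dropped from the integrand relation (`r.integrand x = r'.integrand (Φₘ x)`):
**what is wrong:** without the Jacobian the two integrals differ already for `m = 2`, `n = 1` on a
box (`not_dilationMoveJac_noJacobian`). Refuting theorem:
`Summit.KontsevichZagierPeriods.HurwitzMicroSectors.DilationMoveNegative.orthantCoordPowMove_false_without_jacobian`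
(module `Summits.KontsevichZagierPeriods.KontsevichZagierPeriods.Theorems.DilationMove.Negative.StubLoadBearing`,
sorry-free; it states this body written out). Lesson for the crux: the Jacobian factor is
load-bearing. Orphan (no importer, no user). [folklore] -/
@[deprecated "REFUTED as stated: see theorem \
    Summit.KontsevichZagierPeriods.HurwitzMicroSectors.DilationMoveNegative.orthantCoordPowMove_false_without_jacobian \
    (module Summits.KontsevichZagierPeriods.KontsevichZagierPeriods.Theorems.DilationMove.Negative.StubLoadBearing)"
  (since := "2026-08-16")]
def OrthantCoordPowMoveWithoutJacobian : Prop :=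
  ∀ (n m : ℕ), 1 ≤ m → ∀ (r r' : KZ.IntegralRep n), r.domain ⊆ {x | ∀ i, 0 < x i} →
    IsSemialgebraicMapOn ℚ r.domain (fun x : Fin n → ℝ => BoxIntegral.coordPow m x) →
    r'.domain = (fun x : Fin n → ℝ => BoxIntegral.coordPow m x) '' r.domain →
    (∀ x ∈ r.domain, r.integrand x = r'.integrand (BoxIntegral.coordPow m x)) →
    KZ.of r - KZ.of r' ∈ KZ.changeOfVariablesRel

end Literature.Uncategorized
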